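import Summits.PneNP.PneNP.Theorems.MonotoneBlind.Negative.LoadBearing
import Summits.PneNP.PneNP.Theorems.KarlinRubinMonotoneBlindDelta
import Summits.PneNP.PneNP.Theorems.PlantedcliqueIndistinguishable.Negative.FalseWithoutAdmissible

/-!
# `MonotoneBlind` (stmt-PneNP-18027, route PneNP/KarlinRubin, crux #3) — negative-side lemmas II:
# the `δ`-range and the basis are load-bearing exactly where expected

Crux-disprover output (cdisprove cycle 1) for
`Summit.PneNP.PneNP.Theses.KarlinRubin.MonotoneBlind`:
`∀ δ ∈ (0,1/2), ∀ c, ¬ ∃` a `{∧₂, ∨₂, 0, 1}`-family `C n` of size `≤ n^c` eventually with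
`Pr_{G(n,1/2)}[C n = 1] + Pr_{G(n,1/2,⌈n^{1/2-δ}⌉)}[C n = 0] → 0`.
The crux is NOT refuted (it is the monotone shadow of the nonuniform planted-clique conjecture,
`karlinRubin_monotoneBlind_of_noPolyB2Detector`). Continuing `LoadBearing.lean` (size bound and error
clause), this file settles the remaining three syntactic hypotheses of the crux:

* §1 `errSum_tendsto_zero_of_computes_cliqueFn` — bookkeeping: ANY family that eventually computes
  `CLIQUE(n, t n)` with `(2+η) log₂ n ≤ t n ≤ min (k n) n` has error sum `→ 0` against the planted
  `k n`-clique (type II is `0` eventually, type I `→ 0` by the first-moment bound stmt-PneNP-8686).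
* §2 `monotoneBlind_false_without_posDelta` — the LOWER bound `0 < δ` is load-bearing: with it
  dropped the statement fails at `δ = -1/2` (`k = n`, the planted graph is `Kₙ`): the AND of all
  `C(n,2)` edges is a monotone circuit of size `≤ n²` with error sum `2^{-C(n,2)} → 0`. (By
  `karlinRubin_detects_of_le` detection is a down-set in `δ`; the true boundary is `δ = 0⁻`:
  for every `δ < 0` the max-degree test detects (Kučera 1995) — needs monotone threshold
  circuits, not built here; at `δ = 0` exactly strong monotone detection is open.)
* §3 `errSum_eq_one_of_le_one`, `no_detector_of_half_le`, `monotoneBlind_iff_without_upperDelta` —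
  the UPPER bound `δ < 1/2` is NOT load-bearing: for `δ ≥ 1/2` the planted set has `≤ 1` vertex,
  nothing is planted, `G(n,1/2,k) = G(n,1/2)` (the landed
  `PlantedcliqueIndistinguishable.Negative.plantedCliqueDist_eq_of_le_one` of route PlantedClique's
  refuter file) and every test has error sum identically `1`; so the crux with
  `δ < 1/2` deleted is EQUIVALENT to the crux ("hypothesis possibly unnecessary" — it only excludes
  a vacuous range; a prover may ignore it).
* §4 `exists_oneGate_computes`, `monotoneBlind_false_without_basis` — the basis clause
  `IsOver monotoneBasis01` is load-bearing as a FAN-IN restriction already: with it dropped, ONE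
  gate of fan-in `C(n,2)` computing `CLIQUE(n, 3⌊log₂ n⌋+3)` strongly detects at size `1 ≤ n^0`.
  (Replacing `monotoneBasis01` by `B₂` instead gives the nonuniform planted-clique conjecture,
  believed TRUE — `karlinRubin_monotoneBlind_of_noPolyB2Detector` — so MONOTONICITY itself is
  load-bearing for provability, not for truth.)

Refuter seat refuter-cdisprove-stmt-PneNP-18027-0 (cdisprove, gen 1), 2026-08-17.
-/

set_option linter.dupNamespace false

namespace Summit.PneNP.PneNP.Theorems.MonotoneBlind.Negative

open Literature.Computability.Complexity Literature.Probability.RandomGraphs.PlantedClique Filter Finset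
open Summit.PneNP.PneNP.Theses.KarlinRubin (MonotoneBlind)
open scoped ENNReal

/-! ## §1 Bookkeeping: exact clique tests strongly detect -/

/-- **Exact clique tests strongly detect.** If a family `C n` eventually computes `CLIQUE(n, t n)`
with `(2+η) log₂ n ≤ t n` eventually (some `η > 0`) and `t n ≤ min (k n) n` eventually, then its
`G(n,1/2)`-acceptance plus planted-`k n`-clique rejection tends to `0`: the planted set (of size
`min (k n) n ≥ t n`) contains a `t n`-clique, so type II is `0` eventually, and type I `→ 0` is the
first-moment bound `plantedClique_erdosRenyiNoLargeClique_proof` (stmt-PneNP-8686). No size or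
basis hypothesis. [AlonKrivelevichSudakov1998 §1] [folklore] -/
theorem errSum_tendsto_zero_of_computes_cliqueFn {t k : ℕ → ℕ}
    (ht : ∃ η : ℝ, 0 < η ∧ ∀ᶠ n : ℕ in atTop, (2 + η) * Real.logb 2 (n : ℝ) ≤ (t n : ℝ))
    (htk : ∀ᶠ n : ℕ in atTop, t n ≤ min (k n) n)
    {C : (n : ℕ) → Circuit ((⊤ : SimpleGraph (Fin n)).edgeSet)}
    (hC : ∀ᶠ n : ℕ in atTop, (C n).Computes (cliqueFn n (t n))) :
    Tendsto (fun n : ℕ => (erdosRenyiHalf n).toOuterMeasure {x | (C n).eval x = true} +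
      (plantedCliqueDist n (k n)).toOuterMeasure {x | (C n).eval x = false}) atTop (nhds 0) := by
  classical
  -- type I → 0 : `G(n,1/2)` has no `t n`-clique w.h.p. (first moment, stmt-PneNP-8686)
  have hI : Tendsto (fun n : ℕ => (erdosRenyiHalf n).toOuterMeasure {x | (C n).eval x = true})
      atTop (nhds 0) := by
    have hE := Summit.PneNP.PneNP.Theorems.plantedClique_erdosRenyiNoLargeClique_proof t ht
    refine hE.congr' ?_
    filter_upwards [hC] with n hn
    congr 1
    ext x
    simp only [Set.mem_setOf_eq]
    rw [hn x, cliqueFn_eq_true_iff]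
    simp only [SimpleGraph.CliqueFree, not_forall, not_not]
    constructor
    · rintro ⟨S, h1, h2⟩
      exact ⟨S, ⟨h2, h1⟩⟩
    · rintro ⟨S, hS⟩
      exact ⟨S, hS.card_eq, hS.isClique⟩
  -- type II = 0 eventually : the planted set is a clique of size `min (k n) n ≥ t n`
  have hII : ∀ᶠ n : ℕ in atTop,
      (plantedCliqueDist n (k n)).toOuterMeasure {x | (C n).eval x = false} = 0 := by
    filter_upwards [hC, htk] with n hn hg
    rw [PMF.toOuterMeasure_apply_eq_zero_iff, Set.disjoint_left]
    intro x hx hxf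
    rw [plantedCliqueDist, PMF.support_map] at hx
    obtain ⟨p, hp, rfl⟩ := hx
    obtain ⟨hcard, hcl⟩ := mem_support_plantedCliqueJoint hp
    have hle : t n ≤ p.1.card := by rw [hcard]; exact hg
    obtain ⟨S, hSsub, hScard⟩ := Finset.exists_subset_card_eq hle
    have hclS : (graphOfEdgeVec p.2).IsClique (S : Set (Fin n)) := hcl.subset (by exact_mod_cast hSsub)
    have htrue : (C n).eval p.2 = true := by
      rw [hn p.2, cliqueFn_eq_true_iff]
      exact fun hfree => hfree S ⟨hclS, hScard⟩
    simp only [Set.mem_setOf_eq] at hxf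
    rw [htrue] at hxf
    exact Bool.noConfusion hxf
  refine hI.congr' ?_
  filter_upwards [hII] with n hn
  rw [hn, add_zero]

/-! ## §2 The lower bound `0 < δ` is load-bearing -/

/-- The exponent arithmetic at `δ = -1/2`: `⌈n^{1/2-(-1/2)}⌉ = n`. [folklore] -/
theorem ceil_rpow_half_sub_neg_half (n : ℕ) : ⌈(n : ℝ) ^ (1 / 2 - (-1 / 2 : ℝ))⌉₊ = n := by
  have : (1 / 2 - (-1 / 2 : ℝ)) = 1 := by norm_num
  rw [this, Real.rpow_one, Nat.ceil_natCast]

/-- **A monotone polynomial-size strong detector at `δ = -1/2`.** The AND of all `C(n,2)` edge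
indicators (`CLIQUE(n, n)` as an OR of ANDs, `exists_monotone_computes_cliqueFn_sized` with `s = n`)
is a `{∧₂, ∨₂}`-circuit of size `≤ C(n,2) + 1 ≤ n²` whose error sum against the planted `n`-clique
(the complete graph) is `Pr[G(n,1/2) = Kₙ] = 2^{-C(n,2)} → 0`. [folklore] -/
theorem exists_monotone_poly_strongDetector_neg_half :
    ∃ C : (n : ℕ) → Circuit ((⊤ : SimpleGraph (Fin n)).edgeSet),
      (∀ᶠ n : ℕ in atTop, (C n).IsOver monotoneBasis01 ∧ (C n).size ≤ n ^ 2) ∧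
      Tendsto (fun n : ℕ => (erdosRenyiHalf n).toOuterMeasure {x | (C n).eval x = true} +
        (plantedCliqueDist n ⌈(n : ℝ) ^ (1 / 2 - (-1 / 2 : ℝ))⌉₊).toOuterMeasure
          {x | (C n).eval x = false}) atTop (nhds 0) := by
  classical
  let C : (n : ℕ) → Circuit ((⊤ : SimpleGraph (Fin n)).edgeSet) := fun n =>
    if h : 2 ≤ n then (exists_monotone_computes_cliqueFn_sized h le_rfl).choose
    else Circuit.const _ false
  have hCspec : ∀ n (h : 2 ≤ n), (C n).IsOver monotoneBasis ∧
      (C n).size ≤ n.choose n * (n.choose 2 + 1) ∧ (C n).Computes (cliqueFn n n) := by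
    intro n h
    have hC : C n = (exists_monotone_computes_cliqueFn_sized h le_rfl).choose := dif_pos h
    rw [hC]
    exact (exists_monotone_computes_cliqueFn_sized h le_rfl).choose_spec
  refine ⟨C, ?_, ?_⟩
  · filter_upwards [eventually_ge_atTop 2] with n hn
    obtain ⟨hB, hs, -⟩ := hCspec n hn
    refine ⟨hB.mono monotoneBasis_subset_monotoneBasis01, hs.trans ?_⟩
    rw [Nat.choose_self, one_mul]
    -- `C(n,2) + 1 ≤ n²`
    obtain ⟨k, rfl⟩ : ∃ k, n = k + 1 := ⟨n - 1, by omega⟩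
    rw [Nat.choose_two_right]
    have h1 : (k + 1) * (k + 1 - 1) / 2 ≤ (k + 1) * k := by
      simpa using Nat.div_le_self ((k + 1) * k) 2
    have h2 : (k + 1) * k + 1 ≤ (k + 1) ^ 2 := by nlinarith
    omega
  · have hk : (fun n : ℕ => (erdosRenyiHalf n).toOuterMeasure {x | (C n).eval x = true} +
        (plantedCliqueDist n ⌈(n : ℝ) ^ (1 / 2 - (-1 / 2 : ℝ))⌉₊).toOuterMeasure
          {x | (C n).eval x = false}) = fun n : ℕ =>
        (erdosRenyiHalf n).toOuterMeasure {x | (C n).eval x = true} +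
          (plantedCliqueDist n n).toOuterMeasure {x | (C n).eval x = false} := by
      funext n
      rw [ceil_rpow_half_sub_neg_half]
    rw [hk]
    refine errSum_tendsto_zero_of_computes_cliqueFn (t := fun n => n) (k := fun n => n)
      ⟨1, one_pos, ?_⟩ (Eventually.of_forall fun n => by simp) ?_
    · -- `3 log₂ n ≤ 3 ⌊log₂ n⌋ + 3 ≤ n` eventually
      filter_upwards [tLog_le_eventually (ε := 1) one_pos le_rfl] with n hn
      refine (three_logb_le_tLog n).trans ?_
      exact_mod_cast hn.2
    · filter_upwards [eventually_ge_atTop 2] with n hn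
      exact (hCspec n hn).2.2

/-- **The lower bound `0 < δ` is load-bearing**: the crux with `0 < δ` deleted (everything else as
filed) is FALSE, witnessed at `δ = -1/2`, `c = 2` by the AND of all edges. Any proof of
`MonotoneBlind` must use `0 < δ` (indeed `δ ≥ 0`: for `δ < 0` the max-degree test detects, Kučera
1995; the boundary case `δ = 0`, `k = ⌈√n⌉`, is open for STRONG monotone detection). [folklore] -/
theorem monotoneBlind_false_without_posDelta :
    ¬ ∀ δ : ℝ, δ < 1 / 2 → ∀ c : ℕ, ¬ ∃ C : (n : ℕ) → Circuit ((⊤ : SimpleGraph (Fin n)).edgeSet),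
      (∀ᶠ n : ℕ in atTop, (C n).IsOver monotoneBasis01 ∧ (C n).size ≤ n ^ c) ∧
        Tendsto (fun n : ℕ => (erdosRenyiHalf n).toOuterMeasure {x | (C n).eval x = true} +
          (plantedCliqueDist n ⌈(n : ℝ) ^ (1 / 2 - δ)⌉₊).toOuterMeasure {x | (C n).eval x = false})
          atTop (nhds 0) := by
  intro h
  exact h (-1 / 2) (by norm_num) 2 exists_monotone_poly_strongDetector_neg_half

/-- The same witness kills the crux's `δ`-instance at every `δ ≤ -1/2` (detection is a down-set in
`δ`, `karlinRubin_detects_of_le`). [folklore] -/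
theorem monotoneBlindAt_false_of_le_neg_half {δ : ℝ} (hδ : δ ≤ -1 / 2) :
    ¬ ∀ c : ℕ, ¬ ∃ C : (n : ℕ) → Circuit ((⊤ : SimpleGraph (Fin n)).edgeSet),
      (∀ᶠ n : ℕ in atTop, (C n).IsOver monotoneBasis01 ∧ (C n).size ≤ n ^ c) ∧
        Tendsto (fun n : ℕ => (erdosRenyiHalf n).toOuterMeasure {x | (C n).eval x = true} +
          (plantedCliqueDist n ⌈(n : ℝ) ^ (1 / 2 - δ)⌉₊).toOuterMeasure {x | (C n).eval x = false})
          atTop (nhds 0) := by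
  intro h
  obtain ⟨C, hC, hT⟩ := exists_monotone_poly_strongDetector_neg_half
  exact h 2 ⟨C, hC, Summit.PneNP.PneNP.Theorems.karlinRubin_detects_of_le hδ
    (hC.mono fun n hn => hn.1) hT⟩

/-! ## §3 The upper bound `δ < 1/2` is NOT load-bearing (vacuous range) -/

/-- The error sum of ANY test against the planted `k`-clique with `k ≤ 1` is identically `1`. [folklore] -/
theorem errSum_eq_one_of_le_one {n k : ℕ} (hk : k ≤ 1) (f : EdgeVec n → Bool) :
    (erdosRenyiHalf n).toOuterMeasure {x | f x = true} +
      (plantedCliqueDist n k).toOuterMeasure {x | f x = false} = 1 := by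
  rw [Summit.PneNP.PneNP.Theorems.PlantedcliqueIndistinguishable.Negative.plantedCliqueDist_eq_of_le_one hk,
    PMF.toOuterMeasure_apply,
    PMF.toOuterMeasure_apply, ← ENNReal.tsum_add]
  have : (fun x : EdgeVec n => {x | f x = true}.indicator (erdosRenyiHalf n) x +
      {x | f x = false}.indicator (erdosRenyiHalf n) x) = erdosRenyiHalf n := by
    funext x
    cases h : f x <;> simp [Set.indicator, h]
  rw [this, PMF.tsum_coe]

/-- For `δ ≥ 1/2` the planted set has `⌈n^{1/2-δ}⌉ ≤ 1` vertices (for every `n`, including the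
junk values `0^0 = 1`, `0^{<0} = 0` at `n = 0`). [folklore] -/
theorem ceil_rpow_le_one_of_half_le {δ : ℝ} (hδ : 1 / 2 ≤ δ) (n : ℕ) :
    ⌈(n : ℝ) ^ (1 / 2 - δ)⌉₊ ≤ 1 := by
  have hexp : 1 / 2 - δ ≤ 0 := by linarith
  have h1 : (n : ℝ) ^ (1 / 2 - δ) ≤ 1 := by
    rcases Nat.eq_zero_or_pos n with rfl | hn
    · rcases eq_or_ne (1 / 2 - δ) 0 with h0 | h0
      · rw [h0, Real.rpow_zero]
      · rw [Nat.cast_zero, Real.zero_rpow h0]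
        exact zero_le_one
    · exact Real.rpow_le_one_of_one_le_of_nonpos (by exact_mod_cast hn) hexp
  calc ⌈(n : ℝ) ^ (1 / 2 - δ)⌉₊ ≤ ⌈(1 : ℝ)⌉₊ := Nat.ceil_mono h1
    _ = 1 := Nat.ceil_one

/-- **No test whatsoever detects at `δ ≥ 1/2`** (any size, any basis, any `n ↦ C n`): the error
sum is the constant `1`, which does not tend to `0`. [folklore] -/
theorem no_detector_of_half_le {δ : ℝ} (hδ : 1 / 2 ≤ δ)
    (C : (n : ℕ) → Circuit ((⊤ : SimpleGraph (Fin n)).edgeSet)) :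
    ¬ Tendsto (fun n : ℕ => (erdosRenyiHalf n).toOuterMeasure {x | (C n).eval x = true} +
        (plantedCliqueDist n ⌈(n : ℝ) ^ (1 / 2 - δ)⌉₊).toOuterMeasure {x | (C n).eval x = false})
        atTop (nhds 0) := by
  intro h
  have h1 : (fun n : ℕ => (erdosRenyiHalf n).toOuterMeasure {x | (C n).eval x = true} +
      (plantedCliqueDist n ⌈(n : ℝ) ^ (1 / 2 - δ)⌉₊).toOuterMeasure {x | (C n).eval x = false}) =
      fun _ => (1 : ℝ≥0∞) := by
    funext n
    exact errSum_eq_one_of_le_one (ceil_rpow_le_one_of_half_le hδ n) _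
  rw [h1] at h
  exact zero_ne_one (tendsto_nhds_unique h tendsto_const_nhds)

/-- Hence the `δ`-instance of the crux HOLDS OUTRIGHT for every `δ ≥ 1/2` (trivially: the two laws
coincide). [folklore] -/
theorem monotoneBlindAt_of_half_le {δ : ℝ} (hδ : 1 / 2 ≤ δ) (c : ℕ) :
    ¬ ∃ C : (n : ℕ) → Circuit ((⊤ : SimpleGraph (Fin n)).edgeSet),
      (∀ᶠ n : ℕ in atTop, (C n).IsOver monotoneBasis01 ∧ (C n).size ≤ n ^ c) ∧
        Tendsto (fun n : ℕ => (erdosRenyiHalf n).toOuterMeasure {x | (C n).eval x = true} +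
          (plantedCliqueDist n ⌈(n : ℝ) ^ (1 / 2 - δ)⌉₊).toOuterMeasure {x | (C n).eval x = false})
          atTop (nhds 0) :=
  fun ⟨C, _, hT⟩ => no_detector_of_half_le hδ C hT

/-- **The upper bound `δ < 1/2` is NOT load-bearing**: the crux with the hypothesis `δ < 1/2`
deleted is EQUIVALENT to the crux as filed (the deleted range `δ ≥ 1/2` is the vacuous regime
`k ≤ 1`). Information for the prover: `δ < 1/2` may be ignored. [folklore] -/
theorem monotoneBlind_iff_without_upperDelta :
    (∀ δ : ℝ, 0 < δ → ∀ c : ℕ, ¬ ∃ C : (n : ℕ) → Circuit ((⊤ : SimpleGraph (Fin n)).edgeSet),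
      (∀ᶠ n : ℕ in atTop, (C n).IsOver monotoneBasis01 ∧ (C n).size ≤ n ^ c) ∧
        Tendsto (fun n : ℕ => (erdosRenyiHalf n).toOuterMeasure {x | (C n).eval x = true} +
          (plantedCliqueDist n ⌈(n : ℝ) ^ (1 / 2 - δ)⌉₊).toOuterMeasure {x | (C n).eval x = false})
          atTop (nhds 0)) ↔ MonotoneBlind := by
  constructor
  · intro h δ hδ _ c
    exact h δ hδ c
  · intro h δ hδ c
    rcases lt_or_ge δ (1 / 2) with hlt | hle
    · exact h δ hδ hlt c
    · exact monotoneBlindAt_of_half_le hle c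

/-! ## §4 The basis clause is load-bearing (as a fan-in restriction) -/

/-- **One unbounded fan-in gate computes anything.** Every Boolean function of finitely many
inputs is computed by a circuit with a single gate (of fan-in `|ι|`, from the full basis), hence of
size `≤ 1`. [Vollmer1999 §1.1] [folklore] -/
theorem exists_oneGate_computes {ι : Type*} [Fintype ι] (f : (ι → Bool) → Bool) :
    ∃ C : Circuit ι, C.size ≤ 1 ∧ C.Computes f := by
  classical
  let e := Fintype.equivFin ι
  let g : GateFn := ⟨Fintype.card ι, fun v => f fun i => v (e i)⟩
  have h := CktSize.gate (B := (Set.univ : Set GateFn)) g (Set.mem_univ g) (fun a => e.symm a)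
  obtain ⟨C, -, hs, hev⟩ := h.toCircuit
  refine ⟨C, hs, fun x => ?_⟩
  rw [hev]
  show f (fun i => x (e.symm (e i))) = f x
  simp

/-- **The basis clause is load-bearing**: the crux with `(C n).IsOver monotoneBasis01` deleted (size
bound `≤ n^c` kept, `c = 0`) is FALSE at every admissible `δ` (witnessed at `δ = 1/4`): the single
gate of fan-in `C(n,2)` computing `CLIQUE(n, 3⌊log₂ n⌋ + 3)` has size `1 ≤ n^0` and error sum `→ 0`
(`errSum_tendsto_zero_of_computes_cliqueFn`). So the basis restriction matters already as a FAN-IN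
bound; replacing `monotoneBasis01` by `B₂` instead yields the (believed) nonuniform planted-clique
conjecture (`karlinRubin_monotoneBlind_of_noPolyB2Detector`), i.e. monotonicity is load-bearing for
PROVABILITY only. [folklore] -/
theorem monotoneBlind_false_without_basis :
    ¬ ∀ δ : ℝ, 0 < δ → δ < 1 / 2 → ∀ c : ℕ,
      ¬ ∃ C : (n : ℕ) → Circuit ((⊤ : SimpleGraph (Fin n)).edgeSet),
        (∀ᶠ n : ℕ in atTop, (C n).size ≤ n ^ c) ∧
          Tendsto (fun n : ℕ => (erdosRenyiHalf n).toOuterMeasure {x | (C n).eval x = true} +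
            (plantedCliqueDist n ⌈(n : ℝ) ^ (1 / 2 - δ)⌉₊).toOuterMeasure {x | (C n).eval x = false})
            atTop (nhds 0) := by
  classical
  intro h
  let t : ℕ → ℕ := fun n => 3 * Nat.log 2 n + 3
  let C : (n : ℕ) → Circuit ((⊤ : SimpleGraph (Fin n)).edgeSet) := fun n =>
    (exists_oneGate_computes (cliqueFn n (t n))).choose
  have hC : ∀ n, (C n).size ≤ 1 ∧ (C n).Computes (cliqueFn n (t n)) := fun n =>
    (exists_oneGate_computes (cliqueFn n (t n))).choose_spec
  refine h (1 / 4) (by norm_num) (by norm_num) 0 ⟨C, ?_, ?_⟩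
  · filter_upwards [eventually_ge_atTop 1] with n _
    rw [pow_zero]
    exact (hC n).1
  · refine errSum_tendsto_zero_of_computes_cliqueFn (t := t)
      (k := fun n : ℕ => ⌈(n : ℝ) ^ (1 / 2 - 1 / 4 : ℝ)⌉₊)
      ⟨1, one_pos, Eventually.of_forall three_logb_le_tLog⟩ ?_
      (Eventually.of_forall fun n => (hC n).2)
    filter_upwards [tLog_le_eventually (ε := 1 / 2 - 1 / 4) (by norm_num) (by norm_num)] with n hn
    exact le_min hn.1 hn.2

end Summit.PneNP.PneNP.Theorems.MonotoneBlind.Negative
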